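import Literature.Analysis.FluidPDE.ClassicalGradientSmoothing
import Literature.Analysis.FluidPDE.KNSSLocalSmoothingHolds
import HarnessLib

/-!
# Quantitative higher-order smoothing of bounded classical solutions:
# `‖∇ᵏu(t)‖ ≤ C_k G^{k+1}/νᵏ` after time `ν/G²`

Analysis/FluidPDE proof file (theorems only, everything proved). The `k = 1` case is the tree's
`exists_norm_fderiv_le_of_speed_le` (`ClassicalGradientSmoothing.lean`); this file runs the same
argument for every order `k`: a classical solution of the unforced Navier–Stokes system on `ℝ³`
(`ν = 1`) bounded by `1` and with uniformly square-integrable slices on `(a, T]` is, cut off to `0`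
outside `(a, T)`, a drift-mild pair with zero drift and bound `1`
(`isDriftMildOn_cutoff_of_classical_unit`, by `mild_of_bounded_of_eLpNorm_two_le_of_lt`), so KNSS
2009 (4.10) for drift-mild pairs (`IsDriftMildOn.exists_norm_iteratedFDeriv_le`) bounds
`‖Dᵏu(t)‖` by a constant `C_k` on `(a + 1, T)` (`exists_norm_iteratedFDeriv_le_of_classical_unit`);
the parabolic scaling `u ↦ G⁻¹ u(νt/G², νx/G)` of classical solutions
(`IsClassicalNSSolutionOn.stRescale`; chain rule for homotheties in norm,
`norm_iteratedFDeriv_comp_smul_le`) turns this into the scale-invariant estimate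
`‖Dᵏu(t, x)‖ ≤ C_k G^{k+1} / νᵏ` for `t ∈ (ν/G², T')` under a speed bound `G` on `[0, T']`
(`exists_norm_iteratedFDeriv_le_of_speed_le`). This is the quantitative form of KNSS 2009,
Prop. 4.1 / (4.10) for all `k` (finite energy replacing the mild hypothesis, KNSS 2009 §1 p. 3).

## References

* G. Koch, N. Nadirashvili, G. Seregin, V. Šverák, Acta Math. 203 (2009) = arXiv:0709.3599, §4,
  Prop. 4.1, (4.10). [KochNadirashviliSereginSverak2009]
-/

noncomputable section

open MeasureTheory Set Function Filter
open scoped ENNReal NNReal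

namespace Literature.Analysis.FluidPDE

open UnboundedOperators (heatExtension)

/-! ### Unit viscosity, unit bound -/

/-- **The cut-off of a unit-bounded classical solution is a drift-mild pair with zero drift.**
For a classical solution `(u, p)` of the unforced Navier–Stokes system (`ν = 1`) on `ℝ³ × (a, b)`
with `‖u‖ ≤ 1` on `(a, T] × ℝ³`, `T < b`, and `‖u(t)‖_{L²} ≤ K < ∞` there, the field `U` equal to `u`
on `(a, T)` and to `0` elsewhere satisfies `IsDriftMildOn a T 1 U 0` (the Oseen representation
between any two times of the window is `mild_of_bounded_of_eLpNorm_two_le_of_lt`).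
[cite: KochNadirashviliSereginSverak2009, Lemma 3.1 and §1 p. 3 (arXiv:0709.3599)] -/
theorem isDriftMildOn_cutoff_of_classical_unit {a b T : ℝ}
    {u : ℝ → EuclideanSpace ℝ (Fin 3) → EuclideanSpace ℝ (Fin 3)}
    {p : ℝ → EuclideanSpace ℝ (Fin 3) → ℝ} (hcl : IsClassicalNSSolutionOn (Ioo a b) 1 0 u p)
    (haT : a < T) (hTb : T < b) (hbd : ∀ t ∈ Ioc a T, ∀ x, ‖u t x‖ ≤ 1) {K : ℝ≥0∞} (hK : K ≠ ∞)
    (hL2 : ∀ t ∈ Ioc a T, eLpNorm (u t) 2 volume ≤ K) :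
    IsDriftMildOn a T 1 (fun τ y => if τ ∈ Ioo a T then u τ y else 0)
      (fun _ => (0 : EuclideanSpace ℝ (Fin 3))) := by
  classical
  set S : Set (ℝ × EuclideanSpace ℝ (Fin 3)) := Ioo a T ×ˢ univ with hS
  set U : ℝ → EuclideanSpace ℝ (Fin 3) → EuclideanSpace ℝ (Fin 3) :=
    fun τ y => if τ ∈ Ioo a T then u τ y else 0 with hU
  have hUeq : ∀ {τ : ℝ}, τ ∈ Ioo a T → U τ = u τ := by
    intro τ hτ; funext y; simp only [hU, if_pos hτ]
  have hUunc : uncurry U = S.piecewise (uncurry u) 0 := by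
    funext z
    obtain ⟨τ, y⟩ := z
    by_cases hτ : τ ∈ Ioo a T
    · have hz : (τ, y) ∈ S := mk_mem_prod hτ (mem_univ y)
      simp only [uncurry_apply_pair, hU, if_pos hτ, piecewise_eq_of_mem _ _ _ hz]
    · have hz : (τ, y) ∉ S := fun h => hτ (mem_prod.1 h).1
      simp only [uncurry_apply_pair, hU, if_neg hτ, piecewise_eq_of_notMem _ _ _ hz,
        Pi.zero_apply]
  have hmeas : Measurable (uncurry U) := by
    rw [hUunc]
    refine ContinuousOn.measurable_piecewise ?_ continuousOn_const
      (measurableSet_Ioo.prod MeasurableSet.univ)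
    exact hcl.smooth_velocity.continuousOn.mono (prod_mono (Ioo_subset_Ioo_right hTb.le) subset_rfl)
  refine ⟨hmeas, measurable_const, ?_, fun _ => by simp, ?_⟩
  · intro τ hτ y
    rw [hUeq hτ]
    exact hbd τ ⟨hτ.1, hτ.2.le⟩ y
  · intro s t' hs hst ht' y
    have hsI : s ∈ Ioo a T := ⟨hs, hst.trans ht'⟩
    have htI : t' ∈ Ioo a T := ⟨hs.trans hst, ht'⟩
    have hadd : (fun τ z => U τ z + (0 : EuclideanSpace ℝ (Fin 3))) = U := by
      funext τ z; rw [add_zero]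
    rw [hadd, hUeq htI, hUeq hsI]
    have hcongr : oseenDuhamel 1 s U U t' y = oseenDuhamel 1 s u u t' y :=
      LongLivedOseenSolution.oseenDuhamel_congr (fun τ hτ => hUeq ⟨hs.trans hτ.1, hτ.2.trans ht'⟩)
        (fun τ hτ => hUeq ⟨hs.trans hτ.1, hτ.2.trans ht'⟩) y
    rw [hcongr]
    exact mild_of_bounded_of_eLpNorm_two_le_of_lt hcl haT hTb hbd hK hL2 hs hst ht' y

/-- **Order-`k` derivative bound for unit-bounded classical solutions (`ν = 1`).** For every `k`
there is a constant `C_k ≥ 0` such that: for every classical solution `(u, p)` of the unforced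
Navier–Stokes system (`ν = 1`) on `ℝ³ × (a, b)` with `‖u‖ ≤ 1` on `(a, T] × ℝ³`, `T < b`, and
`‖u(t)‖_{L²} ≤ K < ∞` there, `‖Dᵏu(t)(x)‖ ≤ C_k` for all `x` and all `t ∈ (a + 1, T)` (KNSS (4.10)
for the drift-mild pair `isDriftMildOn_cutoff_of_classical_unit`, `δ = 1`, `N = 1`).
[cite: KochNadirashviliSereginSverak2009, Prop. 4.1 and (4.10) (arXiv:0709.3599 §4)] -/
theorem exists_norm_iteratedFDeriv_le_of_classical_unit (k : ℕ) :
    ∃ C : ℝ, 0 ≤ C ∧ ∀ {a b T : ℝ} {u : ℝ → EuclideanSpace ℝ (Fin 3) → EuclideanSpace ℝ (Fin 3)}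
      {p : ℝ → EuclideanSpace ℝ (Fin 3) → ℝ}, IsClassicalNSSolutionOn (Ioo a b) 1 0 u p →
      a < T → T < b → (∀ t ∈ Ioc a T, ∀ x, ‖u t x‖ ≤ 1) → ∀ {K : ℝ≥0∞}, K ≠ ∞ →
      (∀ t ∈ Ioc a T, eLpNorm (u t) 2 volume ≤ K) →
      ∀ t ∈ Ioo (a + 1) T, ∀ x, ‖iteratedFDeriv ℝ k (u t) x‖ ≤ C := by
  obtain ⟨C, hC⟩ := IsDriftMildOn.exists_norm_iteratedFDeriv_le
    (E := EuclideanSpace ℝ (Fin 3)) k (δ := 1) (N := 1) one_pos zero_le_one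
  refine ⟨max C 0, le_max_right _ _, ?_⟩
  intro a b T u p hcl haT hTb hbd K hK hL2 t ht x
  classical
  have hDM := isDriftMildOn_cutoff_of_classical_unit hcl haT hTb hbd hK hL2
  have htI : t ∈ Ioo a T := ⟨by linarith [ht.1], ht.2⟩
  have h := hC hDM t ht x
  have hUeq : (fun y => if t ∈ Ioo a T then u t y else 0) = u t := by
    funext y; simp only [if_pos htI]
  rw [hUeq] at h
  exact h.trans (le_max_left _ _)

/-! ### General viscosity and bound: the scale-invariant form -/

/-- **Quantitative order-`k` smoothing under a speed bound (scale-invariant form).** For every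
`k` there is a constant `C_k ≥ 0` such that: for `ν > 0`, `G > 0`, every classical solution
`(u, p)` of the unforced Navier–Stokes system with viscosity `ν` on `ℝ³ × [0, T)` that is bounded
by `G` on `[0, T'] × ℝ³` (`T' < T`) and has uniformly square-integrable slices there
(`‖u(t)‖_{L²} ≤ K < ∞`) satisfies `‖Dᵏu(t)(x)‖ ≤ C_k G^{k+1} / νᵏ` for all `x` and all
`t ∈ (ν / G², T')` — KNSS 2009 (4.10) made quantitative by the scaling
`u ↦ G⁻¹ u(νt/G², νx/G)` (unit viscosity, unit bound, unit delay) and the chain rule for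
homotheties `‖Dᵏ[ψ(b ·)](x)‖ ≤ |b|ᵏ ‖Dᵏψ(bx)‖`.
[cite: KochNadirashviliSereginSverak2009, Prop. 4.1 and (4.10) (arXiv:0709.3599 §4)] -/
theorem exists_norm_iteratedFDeriv_le_of_speed_le (k : ℕ) :
    ∃ C : ℝ, 0 ≤ C ∧ ∀ {ν T T' G : ℝ} {u : ℝ → EuclideanSpace ℝ (Fin 3) → EuclideanSpace ℝ (Fin 3)}
      {p : ℝ → EuclideanSpace ℝ (Fin 3) → ℝ}, 0 < ν → 0 < G →
      IsClassicalNSSolutionOn (Ico 0 T) ν 0 u p → 0 < T' → T' < T →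
      (∀ t ∈ Icc 0 T', ∀ x, ‖u t x‖ ≤ G) → ∀ {K : ℝ≥0∞}, K ≠ ∞ →
      (∀ t ∈ Icc 0 T', eLpNorm (u t) 2 volume ≤ K) →
      ∀ t ∈ Ioo (ν / G ^ 2) T', ∀ x,
        ‖iteratedFDeriv ℝ k (u t) x‖ ≤ C * G ^ (k + 1) / ν ^ k := by
  obtain ⟨C₁, hC₁0, hC₁⟩ := exists_norm_iteratedFDeriv_le_of_classical_unit k
  refine ⟨C₁, hC₁0, ?_⟩
  intro ν T T' G u p hν hG hcl hT' hT'T hbd K hK hL2 t ht x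
  -- scaling parameters
  set α : ℝ := G⁻¹ with hα
  set γ : ℝ := ν / G with hγ
  set β : ℝ := ν / G ^ 2 with hβ
  have hαpos : 0 < α := by rw [hα]; positivity
  have hγpos : 0 < γ := by rw [hγ]; positivity
  have hβpos : 0 < β := by rw [hβ]; positivity
  have hβαγ : β = α * γ := by rw [hβ, hα, hγ]; field_simp
  -- the rescaled classical solution, unit viscosity, on `(0, T/β)`
  have hcl' := (hcl.mono Ioo_subset_Ico_self (uniqueDiffOn_Ioo 0 T)).stRescale hαpos hγpos hβαγ 0 0
  have hS : ((fun r => (0 : ℝ) + β * r) ⁻¹' Ioo 0 T) = Ioo 0 (T / β) := by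
    ext r
    simp only [mem_preimage, mem_Ioo, zero_add]
    constructor
    · rintro ⟨h1, h2⟩
      exact ⟨(mul_pos_iff_of_pos_left hβpos).1 h1, (lt_div_iff₀' hβpos).2 h2⟩
    · rintro ⟨h1, h2⟩
      exact ⟨mul_pos hβpos h1, (lt_div_iff₀' hβpos).1 h2⟩
  have hν1 : α * ν / γ = 1 := by rw [hα, hγ]; field_simp
  rw [hS, hν1, smul_stPull_zero] at hcl'
  set w : ℝ → EuclideanSpace ℝ (Fin 3) → EuclideanSpace ℝ (Fin 3) := α • stPull β γ 0 0 u with hw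
  -- bounds for `w` on `(0, T'/β]`
  have hwapp : ∀ s y, w s y = α • u (β * s) (γ • y) := by
    intro s y
    simp only [hw, Pi.smul_apply, stPull_apply, zero_add]
  have hT'β : 0 < T' / β := div_pos hT' hβpos
  have hT'βT : T' / β < T / β := div_lt_div_of_pos_right hT'T hβpos
  have hmemI : ∀ {s : ℝ}, s ∈ Ioc 0 (T' / β) → β * s ∈ Icc 0 T' := by
    intro s hs
    refine ⟨(mul_pos hβpos hs.1).le, ?_⟩
    have := hs.2
    rwa [le_div_iff₀' hβpos] at this
  have hbd' : ∀ s ∈ Ioc 0 (T' / β), ∀ y, ‖w s y‖ ≤ 1 := by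
    intro s hs y
    rw [hwapp, norm_smul, Real.norm_of_nonneg hαpos.le, hα]
    have := hbd (β * s) (hmemI hs) (γ • y)
    calc G⁻¹ * ‖u (β * s) (γ • y)‖ ≤ G⁻¹ * G := by gcongr
      _ = 1 := inv_mul_cancel₀ hG.ne'
  set K' : ℝ≥0∞ := ENNReal.ofReal |α| * (ENNReal.ofReal (γ ^ 3)⁻¹) ^ (1 / 2 : ℝ) * K with hK'
  have hK'top : K' ≠ ∞ := by
    refine ENNReal.mul_ne_top (ENNReal.mul_ne_top ENNReal.ofReal_ne_top ?_) hK
    exact ENNReal.rpow_ne_top_of_nonneg (by norm_num) ENNReal.ofReal_ne_top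
  have hL2' : ∀ s ∈ Ioc 0 (T' / β), eLpNorm (w s) 2 volume ≤ K' := by
    intro s hs
    have h1 : w s = fun y => α • u (β * s) ((0 : EuclideanSpace ℝ (Fin 3)) + γ • y) := by
      funext y; rw [hwapp, zero_add]
    rw [h1]
    refine (eLpNorm_two_smul_comp_affine_le α hγpos 0).trans ?_
    rw [hK']
    gcongr
    exact hL2 (β * s) (hmemI hs)
  -- the unit estimate for `w` at time `t/β ∈ (1, T'/β)`
  have htβ : t / β ∈ Ioo (0 + 1) (T' / β) := by
    refine ⟨?_, div_lt_div_of_pos_right ht.2 hβpos⟩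
    rw [zero_add, lt_div_iff₀ hβpos, one_mul]
    exact ht.1
  have key := hC₁ hcl' hT'β hT'βT hbd' hK'top hL2' (t / β) htβ (γ⁻¹ • x)
  -- undo the scaling in the derivative: `u t = α⁻¹ • w (t/β) (γ⁻¹ • ·)`
  have hγ0 : γ⁻¹ ≠ 0 := inv_ne_zero hγpos.ne'
  have hut : u t = fun z => α⁻¹ • w (t / β) (γ⁻¹ • z) := by
    funext z
    rw [hwapp, smul_smul, inv_mul_cancel₀ hαpos.ne', one_smul, mul_div_cancel₀ _ hβpos.ne',
      smul_smul, mul_inv_cancel₀ hγpos.ne', one_smul]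
  have h1 : ‖iteratedFDeriv ℝ k (u t) x‖ =
      α⁻¹ * ‖iteratedFDeriv ℝ k (fun z => w (t / β) (γ⁻¹ • z)) x‖ := by
    rw [hut, iteratedFDeriv_const_smul_real (fun z => w (t / β) (γ⁻¹ • z)) α⁻¹ k, norm_smul,
      Real.norm_of_nonneg (inv_pos.2 hαpos).le]
  have h2 : ‖iteratedFDeriv ℝ k (fun z => w (t / β) (γ⁻¹ • z)) x‖ ≤
      |γ⁻¹| ^ k * ‖iteratedFDeriv ℝ k (w (t / β)) (γ⁻¹ • x)‖ :=
    norm_iteratedFDeriv_comp_smul_le (w (t / β)) hγ0 k x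
  have h3 : ‖iteratedFDeriv ℝ k (u t) x‖ ≤ α⁻¹ * (|γ⁻¹| ^ k * C₁) := by
    rw [h1]
    refine mul_le_mul_of_nonneg_left (h2.trans ?_) (inv_pos.2 hαpos).le
    exact mul_le_mul_of_nonneg_left key (pow_nonneg (abs_nonneg _) _)
  -- `α⁻¹ |γ⁻¹|ᵏ = G^{k+1} / νᵏ`
  have hαγ : α⁻¹ * (|γ⁻¹| ^ k * C₁) = C₁ * G ^ (k + 1) / ν ^ k := by
    rw [abs_of_pos (inv_pos.2 hγpos), hα, hγ, inv_inv, inv_div, div_pow, pow_succ]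
    field_simp
  rw [hαγ] at h3
  exact h3

end Literature.Analysis.FluidPDE

end
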